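import Literature.MathematicalPhysics.KineticTheory.InfiniteChainGibbsExistenceShift
import Literature.Probability.LatticeModels.MarkovChainMixing
import Literature.Analysis.OperatorTheory.GroundStateMarkovGap
import Summits.AtomisticToContinuum.FouriersLaw.Theorems.EmbeddedDrudeMourreMourreDissolutionGibbsReflection

/-!
# `EmbeddedDrudeMourre.MourreDissolution`, line `separable-vertex-faddeev-pair-sector` —
# Gibbs-state stub S1′ (`stub_gibbsClustering`), helper M1: the transfer-operator (Markov-chain)
# state of the chain WITH ITS WINDOW FORMULA is exponentially `ρ`-mixing

Item `stmt-AtomisticToContinuum-12594` (crux `MourreDissolution` of route `EmbeddedDrudeMourre`,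
sub-problem `FouriersLaw`). The registered stub `stub_gibbsClustering` asks for ONE measure `μ` on
`ℤ → ℝ × ℝ` which is a DLR Gibbs state of `pinnedChain ω₂ lam β γ` at `T > 0`, shift invariant,
Buttà–Marchioro superstable, reflection invariant, AND has summable space–time covariances of the
generators `j₀, h₀` along the Buttà–Marchioro flow. The static half of the last clause is the
exponential `ρ`-mixing of `μ` between `L²` observables of the past `{i ≤ a}` and of the future
`{i ≥ a + n}` — hypothesis `hmix` of the tree's clustering transfer
(`Literature.MathematicalPhysics.KineticTheory.HeatConduction.summable_covariance_comp_chainShift_comp`,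
`continuousAt_tsum_covariance_comp_chainShift_comp`, file `InfiniteChainClusteringTransfer.lean`).

This file PROVES it for the two-sided stationary Markov chain of the transfer operator
(Cassandro–Olivieri–Pellegrinotti–Presutti 1978 §2–3; Georgii 2011 Thm 10.25 / §11.1), keeping the
transfer data and the window formula of `OscillatorChain.exists_transferMarkovState`
(`InfiniteChainGibbsExistenceShift.lean`) in the conclusion, so that EVERY structural property
proved from the window formula (DLR `isChainGibbsMeasure_of_windowDensity`, translation
invariance `isShiftInvariant_of_windowDensity`, superstability
`hasSuperstabilityEstimate_of_windowDensity`, reflection invariance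
`map_reflect_eq_of_windowDensity'`) and the mixing bound refer to ONE AND THE SAME state:

* `exists_transferMarkovState_mixing` (**headline**, registered helper stub, one line) — the
  construction of `exists_transferMarkovState` re-run with the Jentzsch spectral gap kept
  (`Literature.Analysis.OperatorTheory.exists_groundState_markov_gap`: the ground-state Markov
  operator of the strictly positive symmetric Hilbert–Schmidt kernel `e^{-V(q'-q)/T}` on
  `L²(e^{-(p²/2+U)/T} dq dp)` contracts mean-zero functions at rate `ρ = θ/λ₀ < 1`) and the
  Markov-chain covariance bound
  `Literature.Probability.LatticeModels.abs_integral_mul_sub_le_of_dependsOn_halfLine`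
  (conditioning + Markov property + Cauchy–Schwarz + `L²` density of bounded cylinder functions):
  `|∫ f g dμ - ∫ f dμ ∫ g dμ| ≤ 2 ρⁿ (∫ f² dμ)^{1/2} (∫ g² dμ)^{1/2}` for measurable
  `f, g ∈ L²(μ)` depending on `{i ≤ a}` resp. `{i ≥ a + n}` (adapted from the sibling
  `…GreenKuboContinuationRegularMixing.exists_regular_state_mixing`, which does not export the
  window formula);
* `exists_gibbsState_mixing` — for `U, V ≥ 0` continuous, `V` even, `e^{-U/T}, e^{-U/(2T)} ∈ L¹`:
  ONE state which is DLR at `T`, shift invariant, BM-superstable, reflection invariant and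
  exponentially `ρ`-mixing in the `C e^{-m n}` form of `hmix`;
* `exists_gibbsState_mixing_pinnedChain` — the pinned anharmonic chain (`ω₂ > 0`, `lam, β ≥ 0`),
  every `T > 0`.

[cite: Georgii2011, Thm 10.25 and §11.1]
-/

noncomputable section

namespace Summit.AtomisticToContinuum.FouriersLaw.Theorems.MourreDissolution

open MeasureTheory Set Function Finset Filter Literature.Probability.LatticeModels
  Literature.Analysis.OperatorTheory
open Literature.MathematicalPhysics.KineticTheory.HeatConduction
open Literature.MathematicalPhysics.KineticTheory.HeatConduction.OscillatorChain
open scoped ENNReal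

/-! ## §1. The transfer-operator Markov state with its window formula and its mixing rate -/

/-- **The transfer-operator Markov state of the chain, with its window formula AND its exponential
mixing rate** (registered helper stub M1 of `stub_gibbsClustering`). For `T > 0`, `U`, `V`
continuous, `V ≥ 0` even and `e^{-U/T} ∈ L¹` there are measurable transfer data
`w = e^{-(p²/2+U)/T}`, `k(z,z') = e^{-V(q'-q)/T}`, a bounded eigenfunction `φ ≤ B`, an eigenvalue
`0 < L < ∞`, the window densities `D a n = φ(σ_a) φ(σ_{a+n}) ∏ (k L⁻¹) ∏ w` and a probability
measure `μ` on `ℤ → ℝ × ℝ` with the window formula `∫ Φ dμ = (∫⋯∫⁻_{a,…,a+n} Φ · D a n)(η)`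
(verbatim the conclusion of `OscillatorChain.exists_transferMarkovState`), and moreover a rate
`0 ≤ ρ < 1` with `|∫ f g dμ - ∫ f dμ ∫ g dμ| ≤ 2 ρⁿ (∫ f² dμ)^{1/2} (∫ g² dμ)^{1/2}` for all
measurable `f, g ∈ L²(μ)` depending on the sites `≤ a` resp. `≥ a + n` (exponential `ρ`-mixing
of the two-sided stationary chain: Jentzsch's gap `ρ = θ/λ₀` of the transfer operator,
ground-state transform, Markov property, Cauchy–Schwarz; Cassandro–Olivieri–Pellegrinotti–Presutti
1978 §3). Window observables (`f` reading `{a', …, a}`, `g` reading `{a + n, …, b}`) are the special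
case `DependsOn.mono` of the half-lines. [cite: Georgii2011, Thm 10.25 and §11.1] -/
theorem exists_transferMarkovState_mixing : ∀ (P : Literature.MathematicalPhysics.KineticTheory.HeatConduction.OscillatorChain) (T : ℝ), 0 < T → Continuous P.U → Continuous P.V → (∀ r : ℝ, 0 ≤ P.V r) → (∀ r : ℝ, P.V (-r) = P.V r) → MeasureTheory.Integrable (fun q : ℝ => Real.exp (-T⁻¹ * P.U q)) → ∃ (k : ℝ × ℝ → ℝ × ℝ → ENNReal) (φ w : ℝ × ℝ → ENNReal) (L : ENNReal) (B : ℝ) (D : ℤ → ℕ → (ℤ → ℝ × ℝ) → ENNReal) (μ : MeasureTheory.Measure (ℤ → ℝ × ℝ)), Measurable (Function.uncurry k) ∧ Measurable φ ∧ Measurable w ∧ (∀ z : ℝ × ℝ, w z = ENNReal.ofReal (Real.exp (-T⁻¹ * (z.2 ^ 2 / 2 + P.U z.1)))) ∧ (∀ z z' : ℝ × ℝ, k z z' = ENNReal.ofReal (Real.exp (-T⁻¹ * P.V (z'.1 - z.1)))) ∧ (∀ z : ℝ × ℝ, φ z ≤ ENNReal.ofReal B) ∧ L ≠ 0 ∧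 L ≠ ⊤ ∧ (∀ (a : ℤ) (n : ℕ) (σ : ℤ → ℝ × ℝ), D a n σ = φ (σ a) * φ (σ (a + n)) * (∏ j ∈ Finset.range n, k (σ (a + j)) (σ (a + j + 1)) * L⁻¹) * ∏ j ∈ Finset.range (n + 1), w (σ (a + j))) ∧ MeasureTheory.IsProbabilityMeasure μ ∧ (∀ (a : ℤ) (n : ℕ) (Φ : (ℤ → ℝ × ℝ) → ENNReal), Measurable Φ → DependsOn Φ (↑(Finset.Icc a (a + n)) : Set ℤ) → ∀ η : ℤ → ℝ × ℝ, ∫⁻ σ, Φ σ ∂μ = (∫⋯∫⁻_Finset.Icc a (a + n), (fun σ => Φ σ * D a n σ) ∂fun _ : ℤ => (MeasureTheory.volume : MeasureTheory.Measure (ℝ × ℝ))) η) ∧ ∃ ρ : ℝ, 0 ≤ ρ ∧ ρ < 1 ∧ ∀ (a : ℤ) (n : ℕ) (f g : (ℤ → ℝ × ℝ) → ℝ), DependsOn f {i : ℤ | i ≤ a} → DependsOn g {i : ℤ | a + n ≤ i} → Measurable f → Measurable g → MeasureTheory.MemLp f 2 μ → MeasureTheory.MemLp g 2 μ → |(∫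 σ, f σ * g σ ∂μ) - (∫ σ, f σ ∂μ) * (∫ σ, g σ ∂μ)| ≤ 2 * ρ ^ n * (∫ σ, f σ ^ 2 ∂μ) ^ (1 / 2 : ℝ) * (∫ σ, g σ ^ 2 ∂μ) ^ (1 / 2 : ℝ) := by
  -- adapted from `OscillatorChain.exists_transferMarkovState` (InfiniteChainGibbsExistenceShift)
  -- and `…GreenKuboContinuationRegularMixing.exists_regular_state_mixing`
  intro P T hT hUc hVc hV0 hVe hUi
  classical
  -- Step 1: the a priori weight `wt`, the finite measure `ρ_T = wt · Leb`, the kernel `K`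
  obtain ⟨wt, hwt⟩ : ∃ wt : ℝ × ℝ → ℝ, ∀ z, wt z = Real.exp (-T⁻¹ * (z.2 ^ 2 / 2 + P.U z.1)) :=
    ⟨_, fun _ => rfl⟩
  have hwt_eq : wt = fun z => Real.exp (-T⁻¹ * (z.2 ^ 2 / 2 + P.U z.1)) := funext hwt
  have hwtc : Continuous wt := by rw [hwt_eq]; fun_prop
  have hwti : Integrable wt := by rw [hwt_eq]; exact P.integrable_siteWeight hT hUi
  have hwtpos : ∀ z, 0 < wt z := fun z => by rw [hwt]; exact Real.exp_pos _
  set ρT : Measure (ℝ × ℝ) := volume.withDensity fun z => ENNReal.ofReal (wt z) with hρT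
  haveI : IsFiniteMeasure ρT := isFiniteMeasure_withDensity_ofReal hwti.2
  have hwtm : Measurable fun z => ENNReal.ofReal (wt z) :=
    ENNReal.measurable_ofReal.comp hwtc.measurable
  have hρ0 : ρT ≠ 0 := by
    intro h0
    have h1 : ρT univ = 0 := by rw [h0]; rfl
    rw [hρT, withDensity_apply _ MeasurableSet.univ, Measure.restrict_univ,
      lintegral_eq_zero_iff hwtm] at h1
    have h2 : (volume : Measure (ℝ × ℝ))
        {z | (fun z => ENNReal.ofReal (wt z)) z ≠ (0 : ℝ × ℝ → ℝ≥0∞) z} = 0 := h1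
    have h3 : {z : ℝ × ℝ | (fun z => ENNReal.ofReal (wt z)) z ≠ (0 : ℝ × ℝ → ℝ≥0∞) z} = univ :=
      eq_univ_of_forall fun z => (ENNReal.ofReal_pos.2 (hwtpos z)).ne'
    rw [h3] at h2
    exact (isOpen_univ.measure_pos (volume : Measure (ℝ × ℝ)) univ_nonempty).ne' h2
  obtain ⟨K, hK⟩ : ∃ K : ℝ × ℝ → ℝ × ℝ → ℝ, ∀ z z', K z z' = Real.exp (-T⁻¹ * P.V (z'.1 - z.1)) :=
    ⟨_, fun _ _ => rfl⟩
  have hKc : Continuous (uncurry K) := by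
    rw [show uncurry K = fun p : (ℝ × ℝ) × (ℝ × ℝ) => Real.exp (-T⁻¹ * P.V (p.2.1 - p.1.1)) from
      funext fun p => hK p.1 p.2]
    fun_prop
  have hKsm : StronglyMeasurable (uncurry K) := hKc.stronglyMeasurable
  have hKpos : ∀ z z', 0 < K z z' := fun z z' => by rw [hK]; exact Real.exp_pos _
  have hK1 : ∀ z z', ‖K z z'‖ ≤ 1 := fun z z' => by
    rw [Real.norm_eq_abs, abs_of_pos (hKpos z z'), hK, Real.exp_le_one_iff]
    have := hV0 (z'.1 - z.1)
    have := inv_pos.2 hT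
    nlinarith
  have hKsymm : ∀ z z', K z z' = K z' z := fun z z' => by
    rw [hK, hK, ← hVe (z.1 - z'.1), neg_sub]
  have hK0 : ∀ z z', 0 ≤ K z z' := fun z z' => (hKpos z z').le
  have hKC : ∀ z z', K z z' ≤ 1 := fun z z' => by
    have := hK1 z z'
    rwa [Real.norm_eq_abs, abs_of_pos (hKpos z z')] at this
  -- Step 2: Jentzsch's eigenfunction and the gap of the ground-state Markov operator on `L²(ρ_T)`
  obtain ⟨lam, h, B, θ, hlam, hhm, hhpos, hhle, heigρ, hnormρ, hθ0, hθlt, hgapρ⟩ :=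
    exists_groundState_markov_gap (μ := ρT) hKsm hK1 hKsymm hKpos hρ0
  have hconv : ∀ F : ℝ × ℝ → ℝ, ∫ y, F y ∂ρT = ∫ y, wt y * F y := fun F => by
    rw [hρT, integral_withDensity_eq_integral_toReal_smul hwtm
      (ae_of_all _ fun _ => ENNReal.ofReal_lt_top)]
    refine integral_congr_ae (ae_of_all _ fun y => ?_)
    dsimp only
    rw [ENNReal.toReal_ofReal (hwtpos y).le, smul_eq_mul]
  have heig : ∀ x, ∫ y, K x y * h y * wt y = lam * h x := fun x => by
    rw [← heigρ x, hconv]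
    exact integral_congr_ae (ae_of_all _ fun y => by ring)
  have hnorm : ∫ y, h y ^ 2 * wt y = 1 := by
    rw [← hnormρ, hconv]
    exact integral_congr_ae (ae_of_all _ fun y => by ring)
  obtain ⟨q, hq⟩ : ∃ q : ℝ × ℝ → ℝ × ℝ → ℝ, ∀ x y, q x y = (lam * h x)⁻¹ * K x y * h y * wt y :=
    ⟨_, fun _ _ => rfl⟩
  have hPeq : (fun (v : ℝ × ℝ → ℝ) (x : ℝ × ℝ) => ∫ y, q x y * v y) =
      fun (v : ℝ × ℝ → ℝ) (x : ℝ × ℝ) => ∫ y, (lam * h x)⁻¹ * K x y * h y * v y ∂ρT := by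
    funext v x
    rw [hconv]
    exact integral_congr_ae (ae_of_all _ fun y => by dsimp only; rw [hq]; ring)
  have hgap : ∀ u : ℝ × ℝ → ℝ, Measurable u → (∃ M : ℝ, ∀ x, |u x| ≤ M) →
      ∫ x, u x * (h x ^ 2 * wt x) = 0 → ∀ n : ℕ,
        ∫ x, ((fun (v : ℝ × ℝ → ℝ) (x : ℝ × ℝ) => ∫ y, q x y * v y)^[n] u) x ^ 2 *
          (h x ^ 2 * wt x) ≤ (θ / lam) ^ (2 * n) * ∫ x, u x ^ 2 * (h x ^ 2 * wt x) := by
    intro u hum hub hmean n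
    have hmean' : ∫ x, u x * h x ^ 2 ∂ρT = 0 := by
      rw [hconv, ← hmean]
      exact integral_congr_ae (ae_of_all _ fun y => by ring)
    have h1 := hgapρ u hum hub hmean' n
    rw [hconv, hconv, ← hPeq] at h1
    have e1 : ∫ x, ((fun (v : ℝ × ℝ → ℝ) (x : ℝ × ℝ) => ∫ y, q x y * v y)^[n] u) x ^ 2 *
        (h x ^ 2 * wt x) = ∫ x, wt x * (((fun (v : ℝ × ℝ → ℝ) (x : ℝ × ℝ) => ∫ y, q x y * v y)^[n] u)
          x ^ 2 * h x ^ 2) := integral_congr_ae (ae_of_all _ fun x => by ring)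
    have e2 : ∫ x, u x ^ 2 * (h x ^ 2 * wt x) = ∫ x, wt x * (u x ^ 2 * h x ^ 2) :=
      integral_congr_ae (ae_of_all _ fun x => by ring)
    rw [e1, e2]
    exact h1
  -- the `ℝ≥0∞` transfer data
  obtain ⟨k, hk⟩ : ∃ k : ℝ × ℝ → ℝ × ℝ → ℝ≥0∞, ∀ z z', k z z' = ENNReal.ofReal (K z z') :=
    ⟨_, fun _ _ => rfl⟩
  obtain ⟨φ, hφ⟩ : ∃ φ : ℝ × ℝ → ℝ≥0∞, ∀ z, φ z = ENNReal.ofReal (h z) := ⟨_, fun _ => rfl⟩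
  obtain ⟨w, hw⟩ : ∃ w : ℝ × ℝ → ℝ≥0∞, ∀ z, w z = ENNReal.ofReal (wt z) := ⟨_, fun _ => rfl⟩
  obtain ⟨L, hL⟩ : ∃ L : ℝ≥0∞, L = ENNReal.ofReal lam := ⟨_, rfl⟩
  obtain ⟨p, hp⟩ : ∃ p : ℝ × ℝ → ℝ × ℝ → ℝ≥0∞, ∀ x y, p x y = (φ x)⁻¹ * L⁻¹ * k x y * φ y * w y :=
    ⟨_, fun _ _ => rfl⟩
  obtain ⟨D, hD⟩ : ∃ D : ℤ → ℕ → ChainConfig → ℝ≥0∞, ∀ a n σ, D a n σ = φ (σ a) * φ (σ (a + n)) *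
      (∏ j ∈ Finset.range n, k (σ (a + j)) (σ (a + j + 1)) * L⁻¹) *
      ∏ j ∈ Finset.range (n + 1), w (σ (a + j)) := ⟨_, fun _ _ _ => rfl⟩
  obtain ⟨hkm, hφm, hwm', -, -, -, -, hL0, hLt, heigE, hnormE⟩ :=
    ennreal_transferData (ν := (volume : Measure (ℝ × ℝ))) hKc.measurable hhm hwtc.measurable hK0
      hKC hhpos hhle hwtpos hwti hlam heig hnorm hk hφ hw hL
  have hsym : ∀ z y, k z y = k y z := fun z y => by rw [hk, hk, hKsymm]
  -- Step 3: the two-sided stationary Markov chain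
  obtain ⟨μ, hμprob, hμ⟩ := exists_markovChainMeasure (S := ℝ × ℝ)
    (ν := (volume : Measure (ℝ × ℝ))) hkm hφm hwm' hL0 hLt heigE hsym hnormE hD
  haveI := hμprob
  have hw'' : ∀ z, w z = ENNReal.ofReal (Real.exp (-T⁻¹ * (z.2 ^ 2 / 2 + P.U z.1))) := fun z => by
    rw [hw, hwt]
  have hk'' : ∀ z z', k z z' = ENNReal.ofReal (Real.exp (-T⁻¹ * P.V (z'.1 - z.1))) :=
    fun z z' => by rw [hk, hK]
  have hφB : ∀ z, φ z ≤ ENNReal.ofReal B := fun z => by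
    rw [hφ]; exact ENNReal.ofReal_le_ofReal (hhle z)
  have hθl0 : 0 ≤ θ / lam := div_nonneg hθ0 hlam.le
  refine ⟨k, φ, w, L, B, D, μ, hkm, hφm, hwm', hw'', hk'', hφB, hL0, hLt, hD, hμprob, hμ,
    θ / lam, hθl0, (div_lt_one hlam).2 hθlt, fun a n f g hfd hgd hfm hgm hf2 hg2 => ?_⟩
  -- Step 4: exponential mixing
  exact abs_integral_mul_sub_le_of_dependsOn_halfLine (S := ℝ × ℝ)
    (ν := (volume : Measure (ℝ × ℝ))) (μ := μ) hKc.measurable hhm hwtc.measurable hK0 hKC hhpos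
    hhle hwtpos hwti hlam heig hnorm hKsymm hk hφ hw hL hp hq hD hμ hθl0 hgap hfm hfd hgm hgd hf2 hg2

/-! ## §2. One state with all five properties -/

/-- **A DLR Gibbs state of the chain which is shift invariant, superstable, reflection invariant
and exponentially `ρ`-mixing.** Let `T > 0`, `U`, `V` continuous and non-negative, `V` even,
`e^{-U/T}`, `e^{-U/(2T)}` Lebesgue integrable. Then ONE probability measure `μ` on `ℤ → ℝ × ℝ` is
a Gibbs state of `P` at `T` (DLR), invariant under the shift and under the reflection
`σ ↦ σ(-·)`, satisfies Buttà–Marchioro's superstability estimate (2.3), and has exponentially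
decaying correlations between `L²` observables of `{i ≤ a}` and of `{i ≥ a + n}`:
`|∫ f g dμ - ∫ f dμ ∫ g dμ| ≤ C e^{-m n} (∫ f² dμ)^{1/2} (∫ g² dμ)^{1/2}`, `C = 2`, `m > 0` — the
transfer-operator Markov state of `exists_transferMarkovState_mixing`, the first four properties
read off its window formula. [cite: Georgii2011, Thm 10.25 and §11.1] -/
theorem exists_gibbsState_mixing (P : OscillatorChain) {T : ℝ} (hT : 0 < T)
    (hUc : Continuous P.U) (hVc : Continuous P.V) (hU0 : ∀ r, 0 ≤ P.U r) (hV0 : ∀ r, 0 ≤ P.V r)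
    (hVe : ∀ r, P.V (-r) = P.V r)
    (hUi : Integrable (fun q : ℝ => Real.exp (-T⁻¹ * P.U q)))
    (hUi2 : Integrable (fun q : ℝ => Real.exp (-(2 * T)⁻¹ * P.U q))) :
    ∃ μ : Measure ChainConfig, P.IsChainGibbsMeasure T μ ∧ IsShiftInvariant μ ∧
      P.HasSuperstabilityEstimate μ ∧ μ.map (fun (σ : ChainConfig) (x : ℤ) => σ (-x)) = μ ∧
      ∃ C m : ℝ, 0 < m ∧ ∀ (a : ℤ) (n : ℕ) (f g : ChainConfig → ℝ),
        DependsOn f {i : ℤ | i ≤ a} → DependsOn g {i : ℤ | a + n ≤ i} →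
        Measurable f → Measurable g → MemLp f 2 μ → MemLp g 2 μ →
          |(∫ σ, f σ * g σ ∂μ) - (∫ σ, f σ ∂μ) * (∫ σ, g σ ∂μ)| ≤
            C * Real.exp (-(m * n)) * (∫ σ, f σ ^ 2 ∂μ) ^ (1 / 2 : ℝ) *
              (∫ σ, g σ ^ 2 ∂μ) ^ (1 / 2 : ℝ) := by
  have hUm : Measurable P.U := hUc.measurable
  have hVm : Measurable P.V := hVc.measurable
  obtain ⟨k, φ, w, L, B, D, μ, hkm, hφm, hwm, hw', hk', hφB, hL0, -, hD, hμprob, hμ, ρ, hρ0, hρ1,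
    hmix⟩ := exists_transferMarkovState_mixing P T hT hUc hVc hV0 hVe hUi
  haveI := hμprob
  have hsym : ∀ z y, k z y = k y z := fun z y => by rw [hk', hk', ← hVe (z.1 - y.1), neg_sub]
  have hfac : ∀ (Λ : Finset ℤ) (σ : ChainConfig),
      ENNReal.ofReal (Real.exp (-T⁻¹ * hamiltonianIn P.chainPotential chainSupp Λ σ)) =
        (∏ x ∈ Λ, w (σ x)) * ∏ y ∈ bondSet Λ, k (σ y) (σ (y + 1)) := fun Λ σ => by
    rw [P.ofReal_exp_neg_hamiltonianIn T Λ σ]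
    simp only [hw', hk']
  have hZ : ∀ (Λ : Finset ℤ) (η : ChainConfig), (∫⋯∫⁻_Λ, (fun σ =>
      ENNReal.ofReal (Real.exp (-T⁻¹ * hamiltonianIn P.chainPotential chainSupp Λ σ)))
      ∂fun _ : ℤ => (volume : Measure (ℝ × ℝ))) η ≠ ∞ := fun Λ η =>
    (P.lmarginal_boltzmann_lt_top hT hV0 hUi Λ η).ne
  refine ⟨μ, P.isChainGibbsMeasure_of_windowDensity hUm hVm hkm hφm hwm hD hfac hZ hμ,
    isShiftInvariant_of_windowDensity hkm hφm hwm hD hμ,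
    P.hasSuperstabilityEstimate_of_windowDensity hUm hVm hT hU0 hV0 hVe hUi2 hw' hk' hφB hL0 hD hμ,
    map_reflect_eq_of_windowDensity' hkm hφm hwm hsym hD hμ, ?_⟩
  -- the `C e^{-m n}` form of the rate `ρⁿ`
  set r : ℝ := max ρ (1 / 2) with hr
  have hr0 : 0 < r := lt_max_of_lt_right (by norm_num)
  have hr1 : r < 1 := max_lt hρ1 (by norm_num)
  refine ⟨2, -Real.log r, neg_pos.2 (Real.log_neg hr0 hr1),
    fun a n f g hfd hgd hfm hgm hf2 hg2 => ?_⟩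
  have hexp : ρ ^ n ≤ Real.exp (-(-Real.log r * n)) := by
    rw [neg_mul, neg_neg, mul_comm, Real.exp_nat_mul, Real.exp_log hr0]
    exact pow_le_pow_left₀ hρ0 (le_max_left _ _) n
  have hF : 0 ≤ (∫ σ, f σ ^ 2 ∂μ) ^ (1 / 2 : ℝ) :=
    Real.rpow_nonneg (integral_nonneg fun _ => sq_nonneg _) _
  have hG : 0 ≤ (∫ σ, g σ ^ 2 ∂μ) ^ (1 / 2 : ℝ) :=
    Real.rpow_nonneg (integral_nonneg fun _ => sq_nonneg _) _
  refine (hmix a n f g hfd hgd hfm hgm hf2 hg2).trans ?_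
  gcongr

/-! ## §3. The pinned anharmonic chain -/

/-- **The pinned anharmonic chain has, at every temperature, a symmetric superstable Gibbs state
with exponentially decaying correlations.** For `pinnedChain ω₂ lam β γ` (`ω₂ > 0`, `lam, β ≥ 0`,
any `γ`) and `T > 0`: ONE measure on `ℤ → ℝ × ℝ` which is a DLR Gibbs state at `T`, shift
invariant, BM-superstable, invariant under `σ ↦ σ(-·)`, and exponentially `ρ`-mixing between
`L²` observables of `{i ≤ a}` and `{i ≥ a + n}` in the `C e^{-m n}` form consumed by the
clustering transfer (`summable_covariance_comp_chainShift_comp`,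
`continuousAt_tsum_covariance_comp_chainShift_comp`) — the static input of `stub_gibbsClustering`.
[cite: Georgii2011, Thm 10.25 and §11.1] -/
theorem exists_gibbsState_mixing_pinnedChain : ∀ (ω₂ lam β γ : ℝ), 0 < ω₂ → 0 ≤ lam → 0 ≤ β → ∀ (T : ℝ), 0 < T → ∃ μ : MeasureTheory.Measure (ℤ → ℝ × ℝ), (Literature.MathematicalPhysics.KineticTheory.HeatConduction.pinnedChain ω₂ lam β γ).IsChainGibbsMeasure T μ ∧ Literature.MathematicalPhysics.KineticTheory.HeatConduction.IsShiftInvariant μ ∧ (Literature.MathematicalPhysics.KineticTheory.HeatConduction.pinnedChain ω₂ lam β γ).HasSuperstabilityEstimate μ ∧ μ.map (fun (σ : ℤ → ℝ × ℝ) (x : ℤ) => σ (-x)) = μ ∧ ∃ C m : ℝ, 0 < m ∧ ∀ (a : ℤ) (n : ℕ) (f g : (ℤ → ℝ × ℝ) → ℝ), DependsOn f {i : ℤ | i ≤ a} → DependsOn g {i : ℤ | a + n ≤ i} → Measurable f → Measurable g → MeasureTheory.MemLp f 2 μ → MeasureTheory.MemLp g 2 μ → |MeasureTheory.integral μ (fun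 σ => f σ * g σ) - MeasureTheory.integral μ f * MeasureTheory.integral μ g| ≤ C * Real.exp (-(m * n)) * (MeasureTheory.integral μ (fun σ => f σ ^ 2)) ^ (1 / 2 : ℝ) * (MeasureTheory.integral μ (fun σ => g σ ^ 2)) ^ (1 / 2 : ℝ) := by
  intro ω₂ lam β γ hω hl hβ T hT
  refine exists_gibbsState_mixing (pinnedChain ω₂ lam β γ) hT ?_ ?_ ?_ ?_ ?_
    (integrable_exp_neg_pinning hT hω hl β γ) ?_
  · show Continuous fun q : ℝ => ω₂ * q ^ 2 / 2 + lam * q ^ 4 / 4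
    fun_prop
  · show Continuous fun r : ℝ => r ^ 2 / 2 + β * r ^ 4 / 4
    fun_prop
  · intro q
    show 0 ≤ ω₂ * q ^ 2 / 2 + lam * q ^ 4 / 4
    positivity
  · intro r
    show 0 ≤ r ^ 2 / 2 + β * r ^ 4 / 4
    positivity
  · intro r
    show (-r) ^ 2 / 2 + β * (-r) ^ 4 / 4 = r ^ 2 / 2 + β * r ^ 4 / 4
    ring
  · have h2T : 0 < 2 * T := by positivity
    exact integrable_exp_neg_pinning h2T hω hl β γ

end Summit.AtomisticToContinuum.FouriersLaw.Theorems.MourreDissolution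

end
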